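import Summits.AtomisticToContinuum.Crystallization.Theorems.ExcessDecayLiouvillePhononStabilityDefs

/-!
# `PhononStability` (stmt-AtomisticToContinuum-9333), line `contragredient-window-collapse`: stub `stub_certDual`

The dual (metric) band of the pulled-back metric map `B = A⁻ᵀ` over the cell window: if
`189/200·‖x‖ ≤ ‖Ax‖` for all `x` (`CellWindow A`) and `⟪Ax, By⟫ = ⟪x, y⟫` for all `x, y`
(`Contragredient A B`), then `‖By‖ ≤ 200/189·‖y‖` for all `y`.

Proof: `A` has trivial kernel, hence (finite dimension) is surjective; given `y` pick `x` with `Ax = By`;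
then `‖By‖² = ⟪Ax, By⟫ = ⟪x, y⟫ ≤ ‖x‖‖y‖ ≤ (200/189)‖By‖‖y‖`, and divide by `‖By‖` (or `By = 0`). [folklore]
-/

noncomputable section

open scoped BigOperators Classical InnerProductSpace
open Filter Set Function
open Summit.AtomisticToContinuum.Crystallization.Theorems.PhononStabilityNegative
open Literature.MathematicalPhysics.StatisticalMechanics

namespace Summit.AtomisticToContinuum.Crystallization.Theorems.PhononStabilityCWC.Cert

/-- A cell-window operator has trivial kernel, hence is injective. [folklore] -/
private theorem cellWindow_injective_aux
    (A : EuclideanSpace ℝ (Fin 3) →L[ℝ] EuclideanSpace ℝ (Fin 3)) (hA : CellWindow A) :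
    Function.Injective A := by
  refine (injective_iff_map_eq_zero A).2 fun x hx => ?_
  have h := (hA x).1
  rw [hx, norm_zero] at h
  have hx0 : ‖x‖ ≤ 0 := by linarith
  exact norm_eq_zero.1 (le_antisymm hx0 (norm_nonneg x))

/-- A cell-window operator is surjective (an injective endomorphism of a finite-dimensional space).
[folklore] -/
private theorem cellWindow_surjective_aux
    (A : EuclideanSpace ℝ (Fin 3) →L[ℝ] EuclideanSpace ℝ (Fin 3)) (hA : CellWindow A) :
    Function.Surjective A := by
  have h : Function.Injective
      (A : EuclideanSpace ℝ (Fin 3) →ₗ[ℝ] EuclideanSpace ℝ (Fin 3)) :=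
    cellWindow_injective_aux A hA
  exact LinearMap.surjective_of_injective h

/-- The dual band: for `A` in the cell window and `B = A⁻ᵀ` (contragredient to `A`),
`‖By‖ ≤ 200/189·‖y‖` for every `y`. [folklore] -/
theorem stub_certDual : ∀ (A B : EuclideanSpace ℝ (Fin 3) →L[ℝ] EuclideanSpace ℝ (Fin 3)),
    CellWindow A → Contragredient A B →
      ∀ y : EuclideanSpace ℝ (Fin 3), ‖B y‖ ≤ 200 / 189 * ‖y‖ := by
  intro A B hA hAB y
  obtain ⟨x, hx⟩ := cellWindow_surjective_aux A hA (B y)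
  have hxB : ‖x‖ ≤ 200 / 189 * ‖B y‖ := by
    have h := (hA x).1
    rw [hx] at h
    linarith
  have key : ‖B y‖ * ‖B y‖ ≤ 200 / 189 * ‖y‖ * ‖B y‖ :=
    calc ‖B y‖ * ‖B y‖ = inner ℝ x y := by
          rw [← hAB x y, hx, real_inner_self_eq_norm_mul_norm]
      _ ≤ ‖x‖ * ‖y‖ := real_inner_le_norm x y
      _ ≤ 200 / 189 * ‖B y‖ * ‖y‖ := mul_le_mul_of_nonneg_right hxB (norm_nonneg y)
      _ = 200 / 189 * ‖y‖ * ‖B y‖ := by ring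
  rcases (norm_nonneg (B y)).eq_or_lt with h0 | hpos
  · rw [← h0]
    positivity
  · exact le_of_mul_le_mul_right key hpos

end Summit.AtomisticToContinuum.Crystallization.Theorems.PhononStabilityCWC.Cert

end
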